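import Summits.CriticalPhenomena.PercolationContinuityZ3.Theorems.Transplant.BoxProdZ2DropAssembly
import Summits.CriticalPhenomena.PercolationContinuityZ3.Theorems.Transplant.KNCellsBoxProdZ2ConcG
import HarnessLib

/-!
# The (D) assembly at p3-g2's GENERAL-SCHEDULE concentric geometry `cellGeomCG` (geometry of record, lead 14:24:35Z: position-dependent
# fibre radii `ConcRadiiG`, needed at the root anchor where three planar generations share the anchor value `0`):
# `concSchemeG`, `ConcKitAtG`, `theta_pos_of_concKitAtG`, `thetaDropBoxProdZ2_of_concG_inputs` — the named specialisation of the
# geometry-generic `BoxProdZ2DropAssembly` (p220287); supersedes the spare `BoxProdZ2ConcAssemblyF` (p220524, geometry `cellGeomCF`)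

builds on p205010 (kernel theorem, internal audit signed; external expert review pending).
Status sentence (coordinator 2026-08-20T04:30Z): "θ(p_c) = 0 on ℤ^d, all d ≥ 2 — kernel-verified (Lean 4/Mathlib, standard axioms); internal adversarial
audit SIGNED 2026-08-20 04:29Z; external expert review pending."
Lane `prim-bschramm-*`, seat `prim-bschramm-stmt` (gen 5); helper file (`--supports stmt-CriticalPhenomena-4575`).

* `concSchemeG X C w Λ q δc := ⟨cellGeomCG X C w Λ, q, δc⟩` (anchor type `ℕ`, `Λ : ConcRadiiG`);
* **`ConcKitAtG X C w Λ q δc ε' δ₂`** := `KNCells.KSchA.KitAt (X □ ℤ²) (concSchemeG …) (faceDataCG X C w Λ) δ₂ ε'` — the three probabilistic obligations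
  `hQ0 ∧ hface ∧ hreach` (an `abbrev` of the generic `KitAt`, so the generic and the named route agree definitionally);
* **`theta_pos_of_concKitAtG`** — `Λ.WF C`, `0 < q`, `δc ≤ 1`, `ε ≤ 2⁻³²`, `0 ≤ ε'`, `δ₂ ≤ 1`, `4((1-δ₂)^K + ε') ≤ ε`, `ConcKitAtG …` ⟹ `0 < θ_{(w,0)}(q)`
  (p3-g2's records `runGeomCG`, `anchGeomCG`, `sepGeom₂CG`, `exitGeomCG`, `stepsGeomCG`, `levelGeomCG`); `criticalProb_le_of_concKitAtG`;
* **`thetaDropBoxProdZ2_of_concG_inputs`** — (A) finite-volume input families holding at `p` + (B) for every `q ∈ [p/2, p]` where they hold and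
  tubes are subcritical: `∃ C Λ δc ε' δ₂, Λ.WF C ∧ δc ≤ 1 ∧ 0 ≤ ε' ∧ δ₂ ≤ 1 ∧ 4((1-δ₂)^K + ε') ≤ 2⁻³² ∧ ConcKitAtG X C w Λ q δc ε' δ₂` ⟹ `ThetaDropBoxProdZ2`
  (through `thetaDropBoxProdZ2_of_inputs`); `bsConj4_boxProdZ2_of_concG_inputs`.
[cite: KozmaNitzan2024, §4 Theorem 6 (pp. 25–31); §1 p. 2 (approach 1)] [cite: GrimmettPercolation1999, §7.3 pp. 162, 169]
-/

noncomputable section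

open MeasureTheory ProbabilityTheory
open scoped ENNReal Classical

namespace Summit.CriticalPhenomena.PercolationContinuityZ3.Theorems

namespace Transplant

namespace BoxProdZ2

open Literature.Probability.Percolation Literature.Probability.LatticeModels SimpleGraph KNCells
open Literature.Barriers.CriticalPhenomena (IsQuasiTransitive IsGraphAmenable countable_of_connected_of_locallyFinite)

variable {W : Type} [DecidableEq W] (X : SimpleGraph W) [X.LocallyFinite]

/-! ## §1 The scheme and its obligations at the general-schedule geometry -/

/-- **The concentric anchored-cells scheme at density `q`, general-schedule geometry** (`cellGeomCG`). [cite: KozmaNitzan2024, §4 pp. 25–27] -/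
abbrev concSchemeG (C : PCells) (w : W) (Λ : ConcRadiiG) (q : unitInterval) (δc : ℝ) : KSchA (W × Site 2) ℕ :=
  ⟨cellGeomCG X C w Λ, q, δc⟩

/-- **The three probabilistic obligations at density `q` for `cellGeomCG`** (`hQ0 ∧ hface ∧ hreach`, face data `faceDataCG`): the generic
`KSchA.KitAt` at `concSchemeG`. THE target of the instance's step (B). [cite: KozmaNitzan2024, §4 (30), (32), Lemma 10 at the faces, Lemmas 11–12] -/
abbrev ConcKitAtG (C : PCells) (w : W) (Λ : ConcRadiiG) (q : unitInterval) (δc ε' δ₂ : ℝ) : Prop :=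
  KSchA.KitAt (X □ zdGraph 2) (concSchemeG X C w Λ q δc) (faceDataCG X C w Λ) δ₂ ε'

/-! ## §2 The obligations give `θ_{(w,0)}(q) > 0` -/

/-- **`ConcKitAtG` at a positive density gives `θ_{(w,0)}(q) > 0`** (p3-g2's six records for `cellGeomCG` from `Λ.WF C`).
[cite: KozmaNitzan2024, §4 Theorem 6 (pp. 25–31)] -/
theorem theta_pos_of_concKitAtG [Countable W] (C : PCells) (w : W) {Λ : ConcRadiiG} (hΛ : Λ.WF C) {q : unitInterval} (hq : 0 < (q : ℝ))
    {δc ε ε' δ₂ : ℝ} (hδc : δc ≤ 1) (hε : ε ≤ (1 / 2) ^ 32) (hε' : 0 ≤ ε') (hδ₂ : δ₂ ≤ 1) (hKε : 4 * ((1 - δ₂) ^ C.K + ε') ≤ ε)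
    (hkit : ConcKitAtG X C w Λ q δc ε' δ₂) :
    0 < theta (X □ zdGraph 2) (w, (0 : Site 2)) q :=
  KSchA.theta_pos_of_kitAt (S := concSchemeG X C w Λ q δc) (runGeomCG X C w) (anchGeomCG X C w) (sepGeom₂CG X C w hΛ)
    (exitGeomCG X C w hΛ) (stepsGeomCG X C w hΛ) (levelGeomCG X C w hΛ) hδc hε hε' hδ₂ hKε hq hkit

/-- `p_c(X □ ℤ², (w,0)) ≤ q` from the obligations at `q > 0` (general-schedule geometry). [cite: KozmaNitzan2024, §1 p. 2 (approach 1)] -/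
theorem criticalProb_le_of_concKitAtG [Countable W] (C : PCells) (w : W) {Λ : ConcRadiiG} (hΛ : Λ.WF C) {q : unitInterval} (hq : 0 < (q : ℝ))
    {δc ε ε' δ₂ : ℝ} (hδc : δc ≤ 1) (hε : ε ≤ (1 / 2) ^ 32) (hε' : 0 ≤ ε') (hδ₂ : δ₂ ≤ 1) (hKε : 4 * ((1 - δ₂) ^ C.K + ε') ≤ ε)
    (hkit : ConcKitAtG X C w Λ q δc ε' δ₂) :
    criticalProb (X □ zdGraph 2) (w, (0 : Site 2)) ≤ q :=
  OrbitQuotient.criticalProb_le_of_theta_pos _ _ q (theta_pos_of_concKitAtG X C w hΛ hq hδc hε hε' hδ₂ hKε hkit)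

/-! ## §3 The drop node from the general-schedule concentric inputs -/

/-- **THE (D) ASSEMBLY at `cellGeomCG`**: (A) finite families of finite-volume strict inequalities holding at `p` and (B) for every `q ∈ [p/2, p]`
where they hold and tubes are subcritical, planar cells `C`, a well-formed general schedule `Λ : ConcRadiiG`, constants and `ConcKitAtG X C w Λ q δc ε' δ₂`
⟹ `ThetaDropBoxProdZ2` (via the geometry-generic `thetaDropBoxProdZ2_of_inputs`). [cite: KozmaNitzan2024, §1 p. 2 (approach 1), §4 Theorem 6] -/
theorem thetaDropBoxProdZ2_of_concG_inputs
    (h : ∀ {W : Type} [DecidableEq W] (X : SimpleGraph W) [X.LocallyFinite], X.Connected → IsQuasiTransitive X → IsGraphAmenable X →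
      Infinite W → ∀ (w : W) (p : unitInterval),
        (∀ᵐ ω ∂(bondPercolation (X □ zdGraph 2) p), numInfiniteClusters ω ≤ 1) → TubeSubcritical X p →
          0 < theta (X □ zdGraph 2) (w, (0 : Site 2)) p →
            ∃ (ι κ : Type) (s : Finset ι) (A : ι → Set (BondConfig (W × Site 2))) (F : ι → Finset (Sym2 (W × Site 2))) (c : ι → ℝ)
              (t : Finset κ) (B : κ → Set (BondConfig (W × Site 2))) (E : κ → Finset (Sym2 (W × Site 2))) (d : κ → ℝ),
              (∀ i ∈ s, DeterminedBy (A i) (↑(F i) : Set (Sym2 (W × Site 2)))) ∧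
              (∀ j ∈ t, DeterminedBy (B j) (↑(E j) : Set (Sym2 (W × Site 2)))) ∧
              (∀ i ∈ s, c i < (bondPercolation (X □ zdGraph 2) p).real (A i)) ∧
              (∀ j ∈ t, (bondPercolation (X □ zdGraph 2) p).real (B j) < d j) ∧
              ∀ q : unitInterval, (p : ℝ) / 2 ≤ q → (q : ℝ) ≤ p →
                (∀ i ∈ s, c i < (bondPercolation (X □ zdGraph 2) q).real (A i)) →
                (∀ j ∈ t, (bondPercolation (X □ zdGraph 2) q).real (B j) < d j) →
                TubeSubcritical X q →
                  ∃ (C : PCells) (Λ : ConcRadiiG) (δc ε' δ₂ : ℝ), Λ.WF C ∧ δc ≤ 1 ∧ 0 ≤ ε' ∧ δ₂ ≤ 1 ∧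
                    4 * ((1 - δ₂) ^ C.K + ε') ≤ (1 / 2) ^ 32 ∧ ConcKitAtG X C w Λ q δc ε' δ₂) :
    ThetaDropBoxProdZ2 := by
  refine thetaDropBoxProdZ2_of_inputs fun {W} _ X _ hc hqt ha hinf w p hU hT hθ => ?_
  obtain ⟨ι, κ, s, A, F, c, t, B, E, d, hA, hB, hc', hd', hstep⟩ := h X hc hqt ha hinf w p hU hT hθ
  refine ⟨ι, κ, s, A, F, c, t, B, E, d, hA, hB, hc', hd', fun q hq1 hq2 hcq hdq hTq => ?_⟩
  obtain ⟨C, Λ, δc, ε', δ₂, hΛ, hδc, hε', hδ₂, hKε, hkit⟩ := hstep q hq1 hq2 hcq hdq hTq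
  exact ⟨ℕ, concSchemeG X C w Λ q δc, faceDataCG X C w Λ, levelDataC (W := W) C, ε', δ₂, rfl, rfl,
    runGeomCG X C w, anchGeomCG X C w, sepGeom₂CG X C w hΛ, exitGeomCG X C w hΛ, stepsGeomCG X C w hΛ, levelGeomCG X C w hΛ,
    hδc, hε', hδ₂, hKε, hkit⟩

/-- **Hence `BSConj4_boxProdZ2`** from the general-schedule concentric inputs (lead's `bsConj4_boxProdZ2_of_dropNode`) — builds on p205010 (kernel theorem,
internal audit signed; external expert review pending). [cite: BenjaminiSchramm1996, Conj. 4] [cite: KozmaNitzan2024, §1 p. 2 (approach 1)] -/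
theorem bsConj4_boxProdZ2_of_concG_inputs
    (h : ∀ {W : Type} [DecidableEq W] (X : SimpleGraph W) [X.LocallyFinite], X.Connected → IsQuasiTransitive X → IsGraphAmenable X →
      Infinite W → ∀ (w : W) (p : unitInterval),
        (∀ᵐ ω ∂(bondPercolation (X □ zdGraph 2) p), numInfiniteClusters ω ≤ 1) → TubeSubcritical X p →
          0 < theta (X □ zdGraph 2) (w, (0 : Site 2)) p →
            ∃ (ι κ : Type) (s : Finset ι) (A : ι → Set (BondConfig (W × Site 2))) (F : ι → Finset (Sym2 (W × Site 2))) (c : ι → ℝ)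
              (t : Finset κ) (B : κ → Set (BondConfig (W × Site 2))) (E : κ → Finset (Sym2 (W × Site 2))) (d : κ → ℝ),
              (∀ i ∈ s, DeterminedBy (A i) (↑(F i) : Set (Sym2 (W × Site 2)))) ∧
              (∀ j ∈ t, DeterminedBy (B j) (↑(E j) : Set (Sym2 (W × Site 2)))) ∧
              (∀ i ∈ s, c i < (bondPercolation (X □ zdGraph 2) p).real (A i)) ∧
              (∀ j ∈ t, (bondPercolation (X □ zdGraph 2) p).real (B j) < d j) ∧
              ∀ q : unitInterval, (p : ℝ) / 2 ≤ q → (q : ℝ) ≤ p →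
                (∀ i ∈ s, c i < (bondPercolation (X □ zdGraph 2) q).real (A i)) →
                (∀ j ∈ t, (bondPercolation (X □ zdGraph 2) q).real (B j) < d j) →
                TubeSubcritical X q →
                  ∃ (C : PCells) (Λ : ConcRadiiG) (δc ε' δ₂ : ℝ), Λ.WF C ∧ δc ≤ 1 ∧ 0 ≤ ε' ∧ δ₂ ≤ 1 ∧
                    4 * ((1 - δ₂) ^ C.K + ε') ≤ (1 / 2) ^ 32 ∧ ConcKitAtG X C w Λ q δc ε' δ₂) :
    BSConj4_boxProdZ2 :=
  bsConj4_boxProdZ2_of_dropNode (thetaDropBoxProdZ2_of_concG_inputs h)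

end BoxProdZ2

end Transplant

end Summit.CriticalPhenomena.PercolationContinuityZ3.Theorems

end
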